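import Summits.RiemannHypothesis.RiemannHypothesis.Theorems.WeilFormatCDataO106FrontDataW
import Summits.RiemannHypothesis.RiemannHypothesis.Theorems.WeilFormatCDataA1RungCB
import Summits.RiemannHypothesis.RiemannHypothesis.Theorems.S2FormatCE0
import Literature.NumberTheory.LFunctions.YoshidaWindowGramTailMSSines
import Literature.NumberTheory.LFunctions.YoshidaWindowGramMiddleJBox
import Literature.NumberTheory.LFunctions.YoshidaWindowGramTailJFactoredScaled
import Literature.NumberTheory.LFunctions.YoshidaWindowGramTailMSFactored
import Literature.NumberTheory.LFunctions.YoshidaWindowGramTailJDiagTight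
import Summits.RiemannHypothesis.RiemannHypothesis.Theorems.FormatCPsdBands
import Summits.RiemannHypothesis.RiemannHypothesis.Theorems.WeilFormatCDiagShift
import Summits.RiemannHypothesis.RiemannHypothesis.Theorems.FormatCPsdSymmBands
import HarnessLib
import Summits.RiemannHypothesis.RiemannHypothesis.Theorems.WeilFormatCDataO106Tables1
import Summits.RiemannHypothesis.RiemannHypothesis.Theorems.WeilFormatCDataO106Tables2
import Summits.RiemannHypothesis.RiemannHypothesis.Theorems.WeilFormatCDataO106Tables3
import Summits.RiemannHypothesis.RiemannHypothesis.Theorems.WeilFormatCDataO106Tables4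
import Summits.RiemannHypothesis.RiemannHypothesis.Theorems.WeilFormatCDataO106Tables5
import Summits.RiemannHypothesis.RiemannHypothesis.Theorems.WeilFormatCDataO106Tables
import Summits.RiemannHypothesis.RiemannHypothesis.Theorems.WeilFormatCDataO106ColTables1
import Summits.RiemannHypothesis.RiemannHypothesis.Theorems.WeilFormatCDataO106ColTables2
import Summits.RiemannHypothesis.RiemannHypothesis.Theorems.WeilFormatCDataO106ColTables3
import Summits.RiemannHypothesis.RiemannHypothesis.Theorems.WeilFormatCDataO106ColTables4
import Summits.RiemannHypothesis.RiemannHypothesis.Theorems.WeilFormatCDataO106ColTables5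
import Summits.RiemannHypothesis.RiemannHypothesis.Theorems.WeilFormatCDataO106ColTables6
import Summits.RiemannHypothesis.RiemannHypothesis.Theorems.WeilFormatCDataO106ColTables7
import Summits.RiemannHypothesis.RiemannHypothesis.Theorems.WeilFormatCDataO106ColTables8
import Summits.RiemannHypothesis.RiemannHypothesis.Theorems.WeilFormatCDataO106ColTables9
import Summits.RiemannHypothesis.RiemannHypothesis.Theorems.WeilFormatCDataO106ColTables10
import Summits.RiemannHypothesis.RiemannHypothesis.Theorems.WeilFormatCDataO106ColTables11
import Summits.RiemannHypothesis.RiemannHypothesis.Theorems.WeilFormatCDataO106ColTables12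
import Summits.RiemannHypothesis.RiemannHypothesis.Theorems.WeilFormatCDataO106ColTables13
import Summits.RiemannHypothesis.RiemannHypothesis.Theorems.WeilFormatCDataO106ColTables14
import Summits.RiemannHypothesis.RiemannHypothesis.Theorems.WeilFormatCDataO106ColTables15
import Summits.RiemannHypothesis.RiemannHypothesis.Theorems.WeilFormatCDataO106ColTables16
import Summits.RiemannHypothesis.RiemannHypothesis.Theorems.WeilFormatCDataO106ColTables17
import Summits.RiemannHypothesis.RiemannHypothesis.Theorems.WeilFormatCDataO106ColTables18
import Summits.RiemannHypothesis.RiemannHypothesis.Theorems.WeilFormatCDataO106ColTables19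
import Summits.RiemannHypothesis.RiemannHypothesis.Theorems.WeilFormatCDataO106ColTables20
import Summits.RiemannHypothesis.RiemannHypothesis.Theorems.WeilFormatCDataO106ColTables21
import Summits.RiemannHypothesis.RiemannHypothesis.Theorems.WeilFormatCDataO106ColTables22
import Summits.RiemannHypothesis.RiemannHypothesis.Theorems.WeilFormatCDataO106ColTables23
import Summits.RiemannHypothesis.RiemannHypothesis.Theorems.WeilFormatCDataO106ColTables24
import Summits.RiemannHypothesis.RiemannHypothesis.Theorems.WeilFormatCDataO106ColTables25
import Summits.RiemannHypothesis.RiemannHypothesis.Theorems.WeilFormatCDataO106ColTables26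
import Summits.RiemannHypothesis.RiemannHypothesis.Theorems.WeilFormatCDataO106ColTables27
import Summits.RiemannHypothesis.RiemannHypothesis.Theorems.WeilFormatCDataO106ColTables28
import Summits.RiemannHypothesis.RiemannHypothesis.Theorems.WeilFormatCDataO106ColTables29
import Summits.RiemannHypothesis.RiemannHypothesis.Theorems.WeilFormatCDataO106ColTables30
import Summits.RiemannHypothesis.RiemannHypothesis.Theorems.WeilFormatCDataO106ColTables31
import Summits.RiemannHypothesis.RiemannHypothesis.Theorems.WeilFormatCDataO106ColTables32
import Summits.RiemannHypothesis.RiemannHypothesis.Theorems.WeilFormatCDataO106ColTables33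
import Summits.RiemannHypothesis.RiemannHypothesis.Theorems.WeilFormatCDataO106ColTables34
import Summits.RiemannHypothesis.RiemannHypothesis.Theorems.WeilFormatCDataO106ColTables35
import Summits.RiemannHypothesis.RiemannHypothesis.Theorems.WeilFormatCDataO106ColTables
import Summits.RiemannHypothesis.RiemannHypothesis.Theorems.WeilFormatCDataO106CBOddXP1
import Summits.RiemannHypothesis.RiemannHypothesis.Theorems.WeilFormatCDataO106CBOddXP2
import Summits.RiemannHypothesis.RiemannHypothesis.Theorems.WeilFormatCDataO106CBOddXP3
import Summits.RiemannHypothesis.RiemannHypothesis.Theorems.WeilFormatCDataO106CBOddXP4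
import Summits.RiemannHypothesis.RiemannHypothesis.Theorems.WeilFormatCDataO106CBOddXP5
import Summits.RiemannHypothesis.RiemannHypothesis.Theorems.WeilFormatCDataO106CBOddXP6
import Summits.RiemannHypothesis.RiemannHypothesis.Theorems.WeilFormatCDataO106CBOddXP7
import Summits.RiemannHypothesis.RiemannHypothesis.Theorems.WeilFormatCDataO106CBOddXP8
import Summits.RiemannHypothesis.RiemannHypothesis.Theorems.WeilFormatCDataO106CBOddXP9
import Summits.RiemannHypothesis.RiemannHypothesis.Theorems.WeilFormatCDataO106CBOddXP10
import Summits.RiemannHypothesis.RiemannHypothesis.Theorems.WeilFormatCDataO106CBOddXP11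
import Summits.RiemannHypothesis.RiemannHypothesis.Theorems.WeilFormatCDataO106CBOddXP12
import Summits.RiemannHypothesis.RiemannHypothesis.Theorems.WeilFormatCDataO106CBOddXP13
import Summits.RiemannHypothesis.RiemannHypothesis.Theorems.WeilFormatCDataO106CBOddXP14
import Summits.RiemannHypothesis.RiemannHypothesis.Theorems.WeilFormatCDataO106CBOddXP15
import Summits.RiemannHypothesis.RiemannHypothesis.Theorems.WeilFormatCDataO106CBOddXP16
import Summits.RiemannHypothesis.RiemannHypothesis.Theorems.WeilFormatCDataO106CBOddXP17
import Summits.RiemannHypothesis.RiemannHypothesis.Theorems.WeilFormatCDataO106CBOddXP18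
import Summits.RiemannHypothesis.RiemannHypothesis.Theorems.WeilFormatCDataO106CBOddXP19
import Summits.RiemannHypothesis.RiemannHypothesis.Theorems.WeilFormatCDataO106CBOddXP20
import Summits.RiemannHypothesis.RiemannHypothesis.Theorems.WeilFormatCDataO106CBOddXP21
import Summits.RiemannHypothesis.RiemannHypothesis.Theorems.WeilFormatCDataO106CBOddXP22
import Summits.RiemannHypothesis.RiemannHypothesis.Theorems.WeilFormatCDataO106CBOddXP23
import Summits.RiemannHypothesis.RiemannHypothesis.Theorems.WeilFormatCDataO106CBOddXP24
import Summits.RiemannHypothesis.RiemannHypothesis.Theorems.WeilFormatCDataO106CBOddXP25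
import Summits.RiemannHypothesis.RiemannHypothesis.Theorems.WeilFormatCDataO106CBOddDSP1
import Summits.RiemannHypothesis.RiemannHypothesis.Theorems.WeilFormatCDataO106CBOddDSP2
import Summits.RiemannHypothesis.RiemannHypothesis.Theorems.WeilFormatCDataO106CBOddDSP3
import Summits.RiemannHypothesis.RiemannHypothesis.Theorems.WeilFormatCDataO106CBOddDSP4
import Summits.RiemannHypothesis.RiemannHypothesis.Theorems.WeilFormatCDataO106CBOddDSP5
import Summits.RiemannHypothesis.RiemannHypothesis.Theorems.WeilFormatCDataO106CBOddDSP6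
import Summits.RiemannHypothesis.RiemannHypothesis.Theorems.WeilFormatCDataO106CBOddDSP7
import Summits.RiemannHypothesis.RiemannHypothesis.Theorems.WeilFormatCDataO106CBOddDSP8
import Summits.RiemannHypothesis.RiemannHypothesis.Theorems.WeilFormatCDataO106CBOddDSP9
import Summits.RiemannHypothesis.RiemannHypothesis.Theorems.WeilFormatCDataO106CBOddDSP10
import Summits.RiemannHypothesis.RiemannHypothesis.Theorems.WeilFormatCDataO106CBOddDSP11
import Summits.RiemannHypothesis.RiemannHypothesis.Theorems.WeilFormatCDataO106CBOddDSP12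
import Summits.RiemannHypothesis.RiemannHypothesis.Theorems.WeilFormatCDataO106CBOddDSP13
import Summits.RiemannHypothesis.RiemannHypothesis.Theorems.WeilFormatCDataO106CBOddDSP14
import Summits.RiemannHypothesis.RiemannHypothesis.Theorems.WeilFormatCDataO106CBOddDSP15
import Summits.RiemannHypothesis.RiemannHypothesis.Theorems.WeilFormatCDataO106CBOddDSP16
import Summits.RiemannHypothesis.RiemannHypothesis.Theorems.WeilFormatCDataO106CBOddDSP17
import Summits.RiemannHypothesis.RiemannHypothesis.Theorems.WeilFormatCDataO106CBOddDSP18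
import Summits.RiemannHypothesis.RiemannHypothesis.Theorems.WeilFormatCDataO106CBOddDSP19
import Summits.RiemannHypothesis.RiemannHypothesis.Theorems.WeilFormatCDataO106CBOddDSP20
import Summits.RiemannHypothesis.RiemannHypothesis.Theorems.WeilFormatCDataO106CBOddDSP21
import Summits.RiemannHypothesis.RiemannHypothesis.Theorems.WeilFormatCDataO106CBOddDSP22
import Summits.RiemannHypothesis.RiemannHypothesis.Theorems.WeilFormatCDataO106CBOddDSP23
import Summits.RiemannHypothesis.RiemannHypothesis.Theorems.WeilFormatCDataO106CBOddDSP24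
import Summits.RiemannHypothesis.RiemannHypothesis.Theorems.WeilFormatCDataO106CBOddDSP25
import Summits.RiemannHypothesis.RiemannHypothesis.Theorems.WeilFormatCDataO106CBOddDSP26
import Summits.RiemannHypothesis.RiemannHypothesis.Theorems.WeilFormatCDataO106CBOddDSP27
import Summits.RiemannHypothesis.RiemannHypothesis.Theorems.WeilFormatCDataO106CBOddDSP28
import Summits.RiemannHypothesis.RiemannHypothesis.Theorems.WeilFormatCDataO106CBOddDSP29
import Summits.RiemannHypothesis.RiemannHypothesis.Theorems.WeilFormatCDataO106CBOddDSP30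
import Summits.RiemannHypothesis.RiemannHypothesis.Theorems.WeilFormatCDataO106CBOddLP1
import Summits.RiemannHypothesis.RiemannHypothesis.Theorems.WeilFormatCDataO106CBOddLP2
import Summits.RiemannHypothesis.RiemannHypothesis.Theorems.WeilFormatCDataO106CBOddLP3
import Summits.RiemannHypothesis.RiemannHypothesis.Theorems.WeilFormatCDataO106CBOddLP4
import Summits.RiemannHypothesis.RiemannHypothesis.Theorems.WeilFormatCDataO106CBOddLP5
import Summits.RiemannHypothesis.RiemannHypothesis.Theorems.WeilFormatCDataO106CBOddLP6
import Summits.RiemannHypothesis.RiemannHypothesis.Theorems.WeilFormatCDataO106CBOddLP7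
import Summits.RiemannHypothesis.RiemannHypothesis.Theorems.WeilFormatCDataO106CBOddLP8
import Summits.RiemannHypothesis.RiemannHypothesis.Theorems.WeilFormatCDataO106CBOddLP9
import Summits.RiemannHypothesis.RiemannHypothesis.Theorems.WeilFormatCDataO106CBOddLP10
import Summits.RiemannHypothesis.RiemannHypothesis.Theorems.WeilFormatCDataO106CBOddLP11
import Summits.RiemannHypothesis.RiemannHypothesis.Theorems.WeilFormatCDataO106CBOddLP12
import Summits.RiemannHypothesis.RiemannHypothesis.Theorems.WeilFormatCDataO106CBOddPhiP1
import Summits.RiemannHypothesis.RiemannHypothesis.Theorems.WeilFormatCDataO106CBOddPsiP1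
import Summits.RiemannHypothesis.RiemannHypothesis.Theorems.WeilFormatCDataO106CBOddRD
import Summits.RiemannHypothesis.RiemannHypothesis.Theorems.WeilFormatCDataO106FrontData
import Summits.RiemannHypothesis.RiemannHypothesis.Theorems.WeilFormatCDataO106TabValid1
import Summits.RiemannHypothesis.RiemannHypothesis.Theorems.WeilFormatCDataO106TabValid2

/-!
# Format C kernel rung `O106` (a = 53/50, column-band layout): ASSEMBLY of the flat layout, part A of 26 (ladders of TabValid1, TabValid2; split of the 4013-line assembly at block boundaries by prover B g19 for the 400-line cap; blocks byte-identical): every propositional ladder of the kernel files (table/column validity, front door, sines, middle moments, column data, tail factors, Schur rows, (P) + diagonal shift), byte-identical statements and proofs, original order (A g22 restage_flat.py; weil-2 KERNEL-CHAIN-RULES #1)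

Window `a = 53/50`; prime powers in the window: 2, 3, 2^2, 5, 7, 2^3; prime constant A = 2358/1000 (`WeilFormatC.primeCoeff_form_ge_cells_1098`); evaluator parameters S = 2^320, Kpi 160, Kser 190, kred 8, Kexp 55, J 150; full table modes < 321; light column table modes < 2051; units 2^-310 (Schur entries), 2^-154 (column digits, width 157), 2^-148 (tail-factor digits, width 151), 2^-64 (reciprocal weights), 2^-40 (tail base); order-J tail J = 4, θ = 1/2048, η = 1/10 | 4/1.
Design row: sr-gb-rung-b B g21 hp odd λ-run (parity CELL 15 L-side, the first window PAST the (log 8)/2 resonance): a = 53/50, SIX prime powers 2,3,4,5,7,8 (kmax 8), A = 2358/1000 (WeilFormatC.primeCoeff_form_ge_cells_1098), μ = 2^-103, odd 320/640/2048, kit precision S 2^320 / c 310 / Kpi 160 / Kser 190 / Kexp 55 / J 150; pairs with A g24 trialUpper1035sharp = 21e-33; see HOME(B)/CELL14-LSIDE-B-g21.md §4. Generated by sr-gb-rung-a prover A g22 with rh-explicit-weil-2 gen7's generator extended for the odd λ-run (--sector odd --mu-log2; HOME(A)/code-g22/gen7/gramgen7.py sha16 b21c15hp1060001) from `#eval`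 of the tree's `Encl` functions; every datum is re-verified by the kernel in the theorem files (`decide +kernel`). Helper data of the rh-explicit Weil-positivity programme (format C, K-CELL-2), RH-free. [cite: Yoshida1992HermitianForms, §5 (5.15)-(5.16) p. 301; §7 pp. 305–312]
-/

set_option linter.dupNamespace false
set_option exponentiation.threshold 1024
set_option maxRecDepth 200000

-- ===== from WeilFormatCDataO106TabValid1 =====
namespace Summit.RiemannHypothesis.RiemannHypothesis.Theorems.WeilFormatCData.O106
open Literature.NumberTheory.LFunctions Literature.NumberTheory.LFunctions.Yoshida1992 Encl Literature.Analysis.ValidatedNumerics.NumericsMP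

/-- `π ∈ P`. -/
theorem pi_mem : MI.mem (2 ^ 320) Real.pi O106.P := mem_pi_of_checkPi (by norm_num) tP

/-- `a ∈ A`. -/
theorem a_mem : MI.mem (2 ^ 320) O106.a O106.A := by
  unfold a
  exact mem_of_checkFrac tA

/-- `0 < a` (window written out; `a` unfolds to it). -/
theorem a_pos : (0 : ℝ) < (((53 : ℤ) : ℝ) / (50 : ℕ)) := by
  positivity

/-- the constants are valid for `a`. -/
theorem consts_valid : ConstsValid (2 ^ 320) O106.a O106.ks O106.C :=
  constsValid_of_checkConsts (prm := prm) (by norm_num [prm]) (by norm_num [prm]) pi_mem a_mem tC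

/-- the prime data is valid for `a` (prime list written out). -/
theorem primeData : PrimeData O106.a [⟨2, 1⟩, ⟨3, 1⟩, ⟨2, 2⟩, ⟨5, 1⟩, ⟨7, 1⟩, ⟨2, 3⟩] := primeData_of_checkSep (by norm_num) a_mem tK

/-- the special-value table is valid below `20` (partial). -/
theorem tabv20 : TabValid (2 ^ 320) O106.a O106.ks 20 O106.tab := by
  have h0 : TabValid (2 ^ 320) a ks 0 tab := TabValid.zero
  have h1 : TabValid (2 ^ 320) a ks (0 + 1) tab :=
    h0.extend fun n hn hnk ↦ idxValid_of_checkTable (prm := prm) (by norm_num [prm]) a_pos consts_valid tT0 hn hnk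
  have h2 : TabValid (2 ^ 320) a ks (1 + 1) tab :=
    h1.extend fun n hn hnk ↦ idxValid_of_checkTable (prm := prm) (by norm_num [prm]) a_pos consts_valid tT1 hn hnk
  have h3 : TabValid (2 ^ 320) a ks (2 + 1) tab :=
    h2.extend fun n hn hnk ↦ idxValid_of_checkTable (prm := prm) (by norm_num [prm]) a_pos consts_valid tT2 hn hnk
  have h4 : TabValid (2 ^ 320) a ks (3 + 1) tab :=
    h3.extend fun n hn hnk ↦ idxValid_of_checkTable (prm := prm) (by norm_num [prm]) a_pos consts_valid tT3 hn hnk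
  have h5 : TabValid (2 ^ 320) a ks (4 + 1) tab :=
    h4.extend fun n hn hnk ↦ idxValid_of_checkTable (prm := prm) (by norm_num [prm]) a_pos consts_valid tT4 hn hnk
  have h6 : TabValid (2 ^ 320) a ks (5 + 1) tab :=
    h5.extend fun n hn hnk ↦ idxValid_of_checkTable (prm := prm) (by norm_num [prm]) a_pos consts_valid tT5 hn hnk
  have h7 : TabValid (2 ^ 320) a ks (6 + 1) tab :=
    h6.extend fun n hn hnk ↦ idxValid_of_checkTable (prm := prm) (by norm_num [prm]) a_pos consts_valid tT6 hn hnk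
  have h8 : TabValid (2 ^ 320) a ks (7 + 1) tab :=
    h7.extend fun n hn hnk ↦ idxValid_of_checkTable (prm := prm) (by norm_num [prm]) a_pos consts_valid tT7 hn hnk
  have h9 : TabValid (2 ^ 320) a ks (8 + 1) tab :=
    h8.extend fun n hn hnk ↦ idxValid_of_checkTable (prm := prm) (by norm_num [prm]) a_pos consts_valid tT8 hn hnk
  have h10 : TabValid (2 ^ 320) a ks (9 + 1) tab :=
    h9.extend fun n hn hnk ↦ idxValid_of_checkTable (prm := prm) (by norm_num [prm]) a_pos consts_valid tT9 hn hnk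
  have h11 : TabValid (2 ^ 320) a ks (10 + 1) tab :=
    h10.extend fun n hn hnk ↦ idxValid_of_checkTable (prm := prm) (by norm_num [prm]) a_pos consts_valid tT10 hn hnk
  have h12 : TabValid (2 ^ 320) a ks (11 + 1) tab :=
    h11.extend fun n hn hnk ↦ idxValid_of_checkTable (prm := prm) (by norm_num [prm]) a_pos consts_valid tT11 hn hnk
  have h13 : TabValid (2 ^ 320) a ks (12 + 1) tab :=
    h12.extend fun n hn hnk ↦ idxValid_of_checkTable (prm := prm) (by norm_num [prm]) a_pos consts_valid tT12 hn hnk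
  have h14 : TabValid (2 ^ 320) a ks (13 + 1) tab :=
    h13.extend fun n hn hnk ↦ idxValid_of_checkTable (prm := prm) (by norm_num [prm]) a_pos consts_valid tT13 hn hnk
  have h15 : TabValid (2 ^ 320) a ks (14 + 1) tab :=
    h14.extend fun n hn hnk ↦ idxValid_of_checkTable (prm := prm) (by norm_num [prm]) a_pos consts_valid tT14 hn hnk
  have h16 : TabValid (2 ^ 320) a ks (15 + 1) tab :=
    h15.extend fun n hn hnk ↦ idxValid_of_checkTable (prm := prm) (by norm_num [prm]) a_pos consts_valid tT15 hn hnk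
  have h17 : TabValid (2 ^ 320) a ks (16 + 1) tab :=
    h16.extend fun n hn hnk ↦ idxValid_of_checkTable (prm := prm) (by norm_num [prm]) a_pos consts_valid tT16 hn hnk
  have h18 : TabValid (2 ^ 320) a ks (17 + 1) tab :=
    h17.extend fun n hn hnk ↦ idxValid_of_checkTable (prm := prm) (by norm_num [prm]) a_pos consts_valid tT17 hn hnk
  have h19 : TabValid (2 ^ 320) a ks (18 + 1) tab :=
    h18.extend fun n hn hnk ↦ idxValid_of_checkTable (prm := prm) (by norm_num [prm]) a_pos consts_valid tT18 hn hnk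
  have h20 : TabValid (2 ^ 320) a ks (19 + 1) tab :=
    h19.extend fun n hn hnk ↦ idxValid_of_checkTable (prm := prm) (by norm_num [prm]) a_pos consts_valid tT19 hn hnk
  exact h20

end Summit.RiemannHypothesis.RiemannHypothesis.Theorems.WeilFormatCData.O106

-- ===== from WeilFormatCDataO106TabValid2 =====
namespace Summit.RiemannHypothesis.RiemannHypothesis.Theorems.WeilFormatCData.O106
open Literature.NumberTheory.LFunctions Literature.NumberTheory.LFunctions.Yoshida1992 Encl Literature.Analysis.ValidatedNumerics.NumericsMP

/-- the special-value table is valid below `50` (partial). -/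
theorem tabv50 : TabValid (2 ^ 320) O106.a O106.ks 50 O106.tab := by
  have h20 : TabValid (2 ^ 320) a ks 20 tab := tabv20
  have h21 : TabValid (2 ^ 320) a ks (20 + 1) tab :=
    h20.extend fun n hn hnk ↦ idxValid_of_checkTable (prm := prm) (by norm_num [prm]) a_pos consts_valid tT20 hn hnk
  have h22 : TabValid (2 ^ 320) a ks (21 + 1) tab :=
    h21.extend fun n hn hnk ↦ idxValid_of_checkTable (prm := prm) (by norm_num [prm]) a_pos consts_valid tT21 hn hnk
  have h23 : TabValid (2 ^ 320) a ks (22 + 1) tab :=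
    h22.extend fun n hn hnk ↦ idxValid_of_checkTable (prm := prm) (by norm_num [prm]) a_pos consts_valid tT22 hn hnk
  have h24 : TabValid (2 ^ 320) a ks (23 + 1) tab :=
    h23.extend fun n hn hnk ↦ idxValid_of_checkTable (prm := prm) (by norm_num [prm]) a_pos consts_valid tT23 hn hnk
  have h25 : TabValid (2 ^ 320) a ks (24 + 1) tab :=
    h24.extend fun n hn hnk ↦ idxValid_of_checkTable (prm := prm) (by norm_num [prm]) a_pos consts_valid tT24 hn hnk
  have h26 : TabValid (2 ^ 320) a ks (25 + 1) tab :=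
    h25.extend fun n hn hnk ↦ idxValid_of_checkTable (prm := prm) (by norm_num [prm]) a_pos consts_valid tT25 hn hnk
  have h27 : TabValid (2 ^ 320) a ks (26 + 1) tab :=
    h26.extend fun n hn hnk ↦ idxValid_of_checkTable (prm := prm) (by norm_num [prm]) a_pos consts_valid tT26 hn hnk
  have h28 : TabValid (2 ^ 320) a ks (27 + 1) tab :=
    h27.extend fun n hn hnk ↦ idxValid_of_checkTable (prm := prm) (by norm_num [prm]) a_pos consts_valid tT27 hn hnk
  have h29 : TabValid (2 ^ 320) a ks (28 + 1) tab :=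
    h28.extend fun n hn hnk ↦ idxValid_of_checkTable (prm := prm) (by norm_num [prm]) a_pos consts_valid tT28 hn hnk
  have h30 : TabValid (2 ^ 320) a ks (29 + 1) tab :=
    h29.extend fun n hn hnk ↦ idxValid_of_checkTable (prm := prm) (by norm_num [prm]) a_pos consts_valid tT29 hn hnk
  have h31 : TabValid (2 ^ 320) a ks (30 + 1) tab :=
    h30.extend fun n hn hnk ↦ idxValid_of_checkTable (prm := prm) (by norm_num [prm]) a_pos consts_valid tT30 hn hnk
  have h32 : TabValid (2 ^ 320) a ks (31 + 1) tab :=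
    h31.extend fun n hn hnk ↦ idxValid_of_checkTable (prm := prm) (by norm_num [prm]) a_pos consts_valid tT31 hn hnk
  have h33 : TabValid (2 ^ 320) a ks (32 + 1) tab :=
    h32.extend fun n hn hnk ↦ idxValid_of_checkTable (prm := prm) (by norm_num [prm]) a_pos consts_valid tT32 hn hnk
  have h34 : TabValid (2 ^ 320) a ks (33 + 1) tab :=
    h33.extend fun n hn hnk ↦ idxValid_of_checkTable (prm := prm) (by norm_num [prm]) a_pos consts_valid tT33 hn hnk
  have h35 : TabValid (2 ^ 320) a ks (34 + 1) tab :=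
    h34.extend fun n hn hnk ↦ idxValid_of_checkTable (prm := prm) (by norm_num [prm]) a_pos consts_valid tT34 hn hnk
  have h36 : TabValid (2 ^ 320) a ks (35 + 1) tab :=
    h35.extend fun n hn hnk ↦ idxValid_of_checkTable (prm := prm) (by norm_num [prm]) a_pos consts_valid tT35 hn hnk
  have h37 : TabValid (2 ^ 320) a ks (36 + 1) tab :=
    h36.extend fun n hn hnk ↦ idxValid_of_checkTable (prm := prm) (by norm_num [prm]) a_pos consts_valid tT36 hn hnk
  have h38 : TabValid (2 ^ 320) a ks (37 + 1) tab :=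
    h37.extend fun n hn hnk ↦ idxValid_of_checkTable (prm := prm) (by norm_num [prm]) a_pos consts_valid tT37 hn hnk
  have h39 : TabValid (2 ^ 320) a ks (38 + 1) tab :=
    h38.extend fun n hn hnk ↦ idxValid_of_checkTable (prm := prm) (by norm_num [prm]) a_pos consts_valid tT38 hn hnk
  have h40 : TabValid (2 ^ 320) a ks (39 + 1) tab :=
    h39.extend fun n hn hnk ↦ idxValid_of_checkTable (prm := prm) (by norm_num [prm]) a_pos consts_valid tT39 hn hnk
  have h41 : TabValid (2 ^ 320) a ks (40 + 1) tab :=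
    h40.extend fun n hn hnk ↦ idxValid_of_checkTable (prm := prm) (by norm_num [prm]) a_pos consts_valid tT40 hn hnk
  have h42 : TabValid (2 ^ 320) a ks (41 + 1) tab :=
    h41.extend fun n hn hnk ↦ idxValid_of_checkTable (prm := prm) (by norm_num [prm]) a_pos consts_valid tT41 hn hnk
  have h43 : TabValid (2 ^ 320) a ks (42 + 1) tab :=
    h42.extend fun n hn hnk ↦ idxValid_of_checkTable (prm := prm) (by norm_num [prm]) a_pos consts_valid tT42 hn hnk
  have h44 : TabValid (2 ^ 320) a ks (43 + 1) tab :=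
    h43.extend fun n hn hnk ↦ idxValid_of_checkTable (prm := prm) (by norm_num [prm]) a_pos consts_valid tT43 hn hnk
  have h45 : TabValid (2 ^ 320) a ks (44 + 1) tab :=
    h44.extend fun n hn hnk ↦ idxValid_of_checkTable (prm := prm) (by norm_num [prm]) a_pos consts_valid tT44 hn hnk
  have h46 : TabValid (2 ^ 320) a ks (45 + 1) tab :=
    h45.extend fun n hn hnk ↦ idxValid_of_checkTable (prm := prm) (by norm_num [prm]) a_pos consts_valid tT45 hn hnk
  have h47 : TabValid (2 ^ 320) a ks (46 + 1) tab :=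
    h46.extend fun n hn hnk ↦ idxValid_of_checkTable (prm := prm) (by norm_num [prm]) a_pos consts_valid tT46 hn hnk
  have h48 : TabValid (2 ^ 320) a ks (47 + 1) tab :=
    h47.extend fun n hn hnk ↦ idxValid_of_checkTable (prm := prm) (by norm_num [prm]) a_pos consts_valid tT47 hn hnk
  have h49 : TabValid (2 ^ 320) a ks (48 + 1) tab :=
    h48.extend fun n hn hnk ↦ idxValid_of_checkTable (prm := prm) (by norm_num [prm]) a_pos consts_valid tT48 hn hnk
  have h50 : TabValid (2 ^ 320) a ks (49 + 1) tab :=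
    h49.extend fun n hn hnk ↦ idxValid_of_checkTable (prm := prm) (by norm_num [prm]) a_pos consts_valid tT49 hn hnk
  exact h50

end Summit.RiemannHypothesis.RiemannHypothesis.Theorems.WeilFormatCData.O106
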